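import Mathlib.Analysis.SpecialFunctions.OrdinaryHypergeometric
import Mathlib.Analysis.SpecialFunctions.Gamma.Basic
import Mathlib.Analysis.SpecialFunctions.Pow.Real
import Mathlib.MeasureTheory.Measure.Real
import Mathlib.Probability.Process.HittingTime
import Literature.Probability.RandomPlanarGeometry.SLE
import HarnessLib

/-!
# Swallowing of real points by chordal SLE_κ: hitting of real rays and Lawler's crossing probabilities (trunk `Stoch`)

This file vendors, as named facts with precise citations, the three statements about the
*real* Loewner flow of chordal SLE_κ (`κ > 4`) in `ℍ` from `0` to `∞` that make up "Cardy's
formula computation for SLE" (Werner (2007), §3 p. 19; Lawler (2005), §6.7), in the vocabulary of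
`Literature.Probability.RandomPlanarGeometry.LoewnerChain` / `SLE` (driving function
`sleDriving κ ω = √κ B(ω)`, swallowing times `Loewner.swallowingTime`, chains generated by a curve
`Loewner.IsGeneratedByCurve`, canonical space `(ℝ≥0 → ℝ, preWienerMeasure)`):

1. `Literature.Probability.RandomPlanarGeometry.sle_measureReal_swallowingTime_lt` — **Lawler (2005), Prop. 6.33** with the sentence
   preceding it: for `x, y > 0`, `P{T_x < T_{-y}} = P{T_{-x} < T_y} = Ψₐ(y/(x+y))`, where
   `Ψₐ(r) = Γ(2-4a)/(Γ(2-2a)Γ(1-2a)) r^{1-2a} ₂F₁(2a, 1-2a; 2-2a; r)` (`Literature.swallowingProb a r`),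
   `a = 2/κ`. (Deep input: Itô calculus for the Bessel-type flow `dX = (a/X)dt + dB`, optional
   stopping, the hypergeometric equation; Lawler (2005), §1.10–1.11 and §6.7.)
2. `Literature.Probability.RandomPlanarGeometry.sle_swallowingTime_ofReal_eq_firstHit` — **Lawler (2005), Rem. 6.6** ("(6.1) is valid
   for `x ∈ ℝ \ {0}` up to time `T_x = inf{t : x ∈ cl K_t}`") for a chain generated by a curve
   `γ`: the swallowing time of a real `x ≠ 0` is the first time `γ` hits the closed real ray
   from `x` pointing away from `0` (`Literature.realRay x`, `Literature.Probability.RandomPlanarGeometry.firstHit`).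
3. `Literature.Probability.RandomPlanarGeometry.sle_swallowingTime_ofReal_lt_top` — **Lawler (2005), Prop. 6.8** (second item): for
   `κ > 4`, w.p.1 `T_x < ∞` for all `x > 0`.

They are the SLE inputs of the reduction of Cardy's formula for SLE₆ in a conformal rectangle
(`CritPerc.sle_six_measureReal_hitsBefore`, file `CritPercSLEProofs`); items 2 and 3 are also what
`crit-perc.S22` (the locality/restriction computations on the real line) needs. This file also
provides the elementary vocabulary, proved: first hitting times `Literature.Probability.RandomPlanarGeometry.firstHit` of a set by a
path `ℝ≥0 → ℂ` valued in `WithTop ℝ≥0` (the value type of `Loewner.swallowingTime`), identified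
with Mathlib's `MeasureTheory.hittingAfter` (`firstHit_eq_hittingAfter`), and the closed real rays
`Literature.realRay x`.

## Mathlib

We USE `MeasureTheory.hittingAfter` (Mathlib's hitting time "after time `n`" of a set by a
process, `WithTop`-valued, `⊤` if never hit: `firstHit γ S` is `hittingAfter u S 0 ω` for any
process `u` with path `γ = (u · ω)`, `firstHit_eq_hittingAfter`; we keep the one-path `sInf`
form because the deterministic statements below concern a single path and need the order API
`firstHit_le` / `notMem_of_lt_firstHit` / `exists_firstHit_eq_coe`), `WithTop.coe_sInf'`,
`IsClosed.csInf_mem`, `MeasureTheory.Measure.real`, `ordinaryHypergeometric` (`₂F₁`),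
`Real.Gamma`, `Real.rpow`. Mathlib has no SLE / Loewner chains / Bessel-flow hitting
probabilities (searched `Loewner`, `Bessel`, `swallow`, `hitting`).

## References

* G. F. Lawler, *Conformally Invariant Processes in the Plane*, AMS Math. Surveys 114 (2005):
  Rem. 6.6 (p. 148), Prop. 6.8 (p. 150), §6.7 Prop. 6.33 (pp. 163–164), Cor. 6.35.
* W. Werner, *Lectures on two-dimensional critical percolation*, IAS/Park City (2007),
  arXiv:0710.0856, §3 (p. 19).
* G. Lawler, O. Schramm, W. Werner, *Values of Brownian intersection exponents I: Half-plane
  exponents*, Acta Math. 187 (2001), §3, Thm. 3.2 (the original SLE₆ crossing computation).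
* S. Rohde, O. Schramm, *Basic properties of SLE*, Ann. of Math. 161 (2005), §1.
-/

noncomputable section

open Set Filter Topology MeasureTheory Complex
open scoped NNReal ENNReal

namespace Literature.Probability.RandomPlanarGeometry

/-! ### First hitting times of a half-infinite path -/

/-- The **first hitting time** of the set `S` by the path `γ : ℝ≥0 → ℂ`, valued in `WithTop ℝ≥0`
(the value type of `Literature.Probability.RandomPlanarGeometry.Loewner.swallowingTime`): the infimum of the times `t` with `γ t ∈ S`,
`⊤` if `S` is never hit. This is Mathlib's `MeasureTheory.hittingAfter u S 0 ω` for any process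
`u` whose `ω`-path is `γ` (`firstHit_eq_hittingAfter`); the one-path `sInf` form is kept for the
deterministic statements of this file. Lawler (2005), §6.7 (`t_* = inf{t : γ(t) ∈ [1, ∞)}`).
[folklore] -/
def firstHit (γ : ℝ≥0 → ℂ) (S : Set ℂ) : WithTop ℝ≥0 :=
  sInf ((fun t : ℝ≥0 ↦ (t : WithTop ℝ≥0)) '' {t | γ t ∈ S})

/-- If `S` is never hit, the first hitting time is `⊤`. [folklore] -/
theorem firstHit_eq_top {γ : ℝ≥0 → ℂ} {S : Set ℂ} (h : ∀ t, γ t ∉ S) : firstHit γ S = ⊤ := by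
  simp [firstHit, Set.eq_empty_of_forall_notMem (s := {t : ℝ≥0 | γ t ∈ S}) h]

/-- **Bridge to Mathlib's hitting times.** For a process `u : ℝ≥0 → Ω → ℂ`, the first hitting
time of `S` by the path `t ↦ u t ω` is `MeasureTheory.hittingAfter u S 0 ω`. [folklore] -/
theorem firstHit_eq_hittingAfter {Ω : Type*} (u : ℝ≥0 → Ω → ℂ) (S : Set ℂ) (ω : Ω) :
    firstHit (fun t ↦ u t ω) S = hittingAfter u S 0 ω := by
  have hset : {i : ℝ≥0 | 0 ≤ i ∧ u i ω ∈ S} = {t | u t ω ∈ S} := by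
    ext t
    simp
  rw [hittingAfter_def]
  dsimp only
  rw [hset]
  split_ifs with h
  · obtain ⟨j, -, hj⟩ := h
    exact (WithTop.coe_sInf' ⟨j, hj⟩ (OrderBot.bddBelow _)).symm
  · rw [not_exists] at h
    exact firstHit_eq_top fun t ht ↦ h t ⟨zero_le, ht⟩

/-- A hitting time bounds the first hitting time from above. [folklore] -/
theorem firstHit_le {γ : ℝ≥0 → ℂ} {S : Set ℂ} {t : ℝ≥0} (h : γ t ∈ S) : firstHit γ S ≤ t :=
  sInf_le ⟨t, h, rfl⟩

/-- Strictly before the first hitting time the path is off `S`. [folklore] -/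
theorem notMem_of_lt_firstHit {γ : ℝ≥0 → ℂ} {S : Set ℂ} {t : ℝ≥0}
    (h : (t : WithTop ℝ≥0) < firstHit γ S) : γ t ∉ S :=
  fun ht ↦ lt_irrefl _ (h.trans_le (firstHit_le ht))

/-- Monotonicity in the target set. [folklore] -/
theorem firstHit_mono (γ : ℝ≥0 → ℂ) {S S' : Set ℂ} (h : S ⊆ S') : firstHit γ S' ≤ firstHit γ S :=
  sInf_le_sInf (image_mono fun _ ht ↦ h ht)

/-- For a continuous path and a closed set, a finite first hitting time is attained: it is a
genuine time `t₀` with `γ t₀ ∈ S`. [folklore] -/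
theorem exists_firstHit_eq_coe {γ : ℝ≥0 → ℂ} {S : Set ℂ} (hγ : Continuous γ) (hS : IsClosed S)
    (h : firstHit γ S ≠ ⊤) : ∃ t₀ : ℝ≥0, firstHit γ S = t₀ ∧ γ t₀ ∈ S := by
  have hne : {t : ℝ≥0 | γ t ∈ S}.Nonempty := by
    by_contra hemp
    rw [not_nonempty_iff_eq_empty] at hemp
    exact h (by simp [firstHit, hemp])
  have hcl : IsClosed {t : ℝ≥0 | γ t ∈ S} := hS.preimage hγ
  refine ⟨sInf {t | γ t ∈ S}, ?_, hcl.csInf_mem hne (OrderBot.bddBelow _)⟩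
  rw [firstHit, ← WithTop.coe_sInf' hne (OrderBot.bddBelow _)]

/-! ### Closed real rays pointing away from the origin -/

/-- The **closed real ray from `x` pointing away from `0`**: `[x, ∞)` for `x > 0`, `(-∞, x]` for
`x < 0` (all of `ℝ` for the unused value `x = 0`), as a subset of `ℂ`. For the chordal Loewner
chain generated by a curve `γ`, a real point `x ≠ 0` belongs to `cl K_t` iff `γ[0,t]` meets
this ray (Lawler (2005), Rem. 6.6 and §6.7); under a chordal uniformizing map `0 ↦ a`, `∞ ↦ c`
of a conformal rectangle `(Ω; a, b, c, d)` the arcs `(bc)`, `(cd)` pull back to two such rays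
(`ConformalRectangle.exists_rays_of_isChordalUniformizing_of_disc` of `ChordalBoundary`).
[folklore] -/
def realRay (x : ℝ) : Set ℂ :=
  {z : ℂ | z.im = 0 ∧ (0 < x → x ≤ z.re) ∧ (x < 0 → z.re ≤ x)}

/-- Membership in a real ray, unfolded. [folklore] -/
theorem mem_realRay_iff {x : ℝ} {z : ℂ} :
    z ∈ realRay x ↔ z.im = 0 ∧ (0 < x → x ≤ z.re) ∧ (x < 0 → z.re ≤ x) :=
  Iff.rfl

/-- The base point lies on its ray. [folklore] -/
theorem ofReal_mem_realRay (x : ℝ) : (x : ℂ) ∈ realRay x :=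
  ⟨ofReal_im x, fun _ ↦ (ofReal_re x).ge, fun _ ↦ (ofReal_re x).le⟩

/-- Real rays are closed. [folklore] -/
theorem isClosed_realRay (x : ℝ) : IsClosed (realRay x) := by
  have h1 : IsClosed {z : ℂ | z.im = 0} := isClosed_eq continuous_im continuous_const
  have h2 : IsClosed {z : ℂ | 0 < x → x ≤ z.re} := by
    by_cases hx : 0 < x
    · simpa [hx] using isClosed_le continuous_const continuous_re
    · simp [hx]
  have h3 : IsClosed {z : ℂ | x < 0 → z.re ≤ x} := by
    by_cases hx : x < 0
    · simpa [hx] using isClosed_le continuous_re continuous_const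
    · simp [hx]
  simpa only [realRay, setOf_and] using h1.inter (h2.inter h3)

/-- Rays from points of opposite signs are disjoint. [folklore] -/
theorem disjoint_realRay {u v : ℝ} (hu : u < 0) (hv : 0 < v) : Disjoint (realRay u) (realRay v) := by
  rw [disjoint_left]
  rintro z ⟨-, -, hzu⟩ ⟨-, hzv, -⟩
  have h1 := hzu hu
  have h2 := hzv hv
  linarith

/-- Rays on the positive side are nested: `realRay y ⊆ realRay x` for `0 < x ≤ y`. [folklore] -/
theorem realRay_subset_realRay_of_pos {x y : ℝ} (hx : 0 < x) (hxy : x ≤ y) : realRay y ⊆ realRay x := by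
  rintro z ⟨hz, hzy, -⟩
  exact ⟨hz, fun _ ↦ hxy.trans (hzy (hx.trans_le hxy)), fun h ↦ absurd hx h.le.not_gt⟩

/-! ### Named facts: the real Loewner flow of chordal SLE_κ -/

/-- **Lawler's swallowing probability** `Ψₐ(r) = Γ(2-4a)/(Γ(2-2a)Γ(1-2a)) · r^{1-2a} ·
₂F₁(2a, 1-2a; 2-2a; r)`, the right-hand side of Lawler (2005), Prop. 6.33 (`a = 2/κ`,
`r = y/(y+1)`); for `a = 1/3` (`κ = 6`) it is Cardy's function
(`swallowingProb_one_third` in `CritPercSLEProofs`). Meant for `r ∈ [0, 1]`, `0 < a < 1/2`;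
elsewhere the value is whatever `Real.rpow`, `Real.Gamma` and Mathlib's `₂F₁` give.
[cite: Lawler2005, Prop. 6.33] -/
def swallowingProb (a r : ℝ) : ℝ :=
  Real.Gamma (2 - 4 * a) / (Real.Gamma (2 - 2 * a) * Real.Gamma (1 - 2 * a)) *
    r ^ (1 - 2 * a) * ₂F₁ (2 * a) (1 - 2 * a) (2 - 2 * a) r

/-- **Crossing (swallowing) probabilities for chordal SLE_κ, `κ > 4`** (Lawler (2005), §6.7,
Prop. 6.33 together with the sentence preceding it, pp. 163–164). Let `γ` be the chordal SLE_κ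
path in `ℍ` from `0` to `∞` (`κ > 4`), `T_z` the swallowing time of `z`
(`Literature.Probability.RandomPlanarGeometry.Loewner.swallowingTime` of the driving function `√κ B`), and `x, y > 0`. Then, "by scaling
and symmetry, `P{T_{-y} > T_x} = P{T_y > T_{-x}} = P{T_{-y/x} > T_1}`", and (Prop. 6.33)
`P{T_{-y} > T_1} = Γ(2-4a)/(Γ(2-2a)Γ(1-2a)) (y/(y+1))^{1-2a} ₂F₁(2a,1-2a;2-2a; y/(y+1))`,
`a = 2/κ`; i.e. both `P{T_x < T_{-y}}` and `P{T_{-x} < T_y}` equal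
`swallowingProb (2/κ) (y/(x+y))`. Stated on the canonical space `(ℝ≥0 → ℝ, preWienerMeasure)`
with `Measure.real`. Proof in print: `X_t = ĝ_t(1)`, `Y_t = ĝ_t(-y)` follow the Bessel-type SDE
`dX = (a/X)dt + dB`; `Z = X/(X-Y)`, after a time change, is a diffusion whose hitting
probabilities solve the hypergeometric equation `u(1-u)ψ'' + (2a-4au)ψ' = 0`, `ψ(0)=0`,
`ψ(1)=1`. Also Lawler–Schramm–Werner, Acta Math. 187 (2001), Thm. 3.2 (`κ = 6`).
[cite: Lawler2005, Prop. 6.33] -/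
def sle_measureReal_swallowingTime_lt : Prop :=
  ∀ {κ : ℝ≥0}, 4 < κ → ∀ {x y : ℝ}, 0 < x → 0 < y →
    Process.preWienerMeasure.real {ω | Loewner.swallowingTime (sleDriving κ ω) (x : ℂ) <
        Loewner.swallowingTime (sleDriving κ ω) ((-y : ℝ) : ℂ)} =
      swallowingProb (2 / (κ : ℝ)) (y / (x + y)) ∧
    Process.preWienerMeasure.real {ω | Loewner.swallowingTime (sleDriving κ ω) ((-x : ℝ) : ℂ) <
        Loewner.swallowingTime (sleDriving κ ω) (y : ℂ)} =
      swallowingProb (2 / (κ : ℝ)) (y / (x + y))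

/-- **Swallowing of real points is hitting of real rays** (Lawler (2005), Remark 6.6, p. 148:
"The equation (6.1) is also valid for `x ∈ ℝ \\ {0}` and is valid up to time
`T_x = inf{t : x ∈ cl K_t}`"). For the SLE_κ Loewner chain of a sample path `ω` (driving
function `√κ B(ω)`, started at `0`) generated by the curve `γ`, and a real `x ≠ 0`, the
swallowing time of `x` — the lifetime of the real Loewner flow `ġ = 2/(g - W)` started at `x`,
`Literature.Probability.RandomPlanarGeometry.Loewner.swallowingTime` — is the first time `γ` hits the closed real ray from `x` pointing
away from `0` (`Literature.realRay x`): for a chain generated by `γ` (hulls `K_t` = complement of the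
unbounded component of `ℍₒ \\ γ[0,t]`), `x ∈ cl K_t` iff `γ[0,t]` meets that ray. Deterministic
statement about every sample path. [cite: Lawler2005, Rem. 6.6] -/
def sle_swallowingTime_ofReal_eq_firstHit : Prop :=
  ∀ (κ : ℝ≥0) (ω : ℝ≥0 → ℝ) {γ : ℝ≥0 → ℂ}, Loewner.IsGeneratedByCurve (sleDriving κ ω) γ →
    ∀ {x : ℝ}, x ≠ 0 → Loewner.swallowingTime (sleDriving κ ω) x = firstHit γ (realRay x)

/-- **Every positive real point is swallowed by SLE_κ, `κ > 4`** (Lawler (2005), Prop. 6.8, second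
item, p. 150: "If `κ > 4`, then w.p.1 `T_x < ∞` for all `x > 0`"; from the Bessel-process
dichotomy of Prop. 1.21 for `dX = (a/X)dt + dB`, `a = 2/κ < 1/2`). On the canonical space:
for `preWienerMeasure`-a.e. `ω`, every `x > 0` has finite swallowing time under the Loewner flow
driven by `√κ B(ω)`. [cite: Lawler2005, Prop. 6.8] -/
def sle_swallowingTime_ofReal_lt_top : Prop :=
  ∀ {κ : ℝ≥0}, 4 < κ →
    ∀ᵐ ω ∂Process.preWienerMeasure, ∀ x : ℝ, 0 < x → Loewner.swallowingTime (sleDriving κ ω) x < ⊤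

end Literature.Probability.RandomPlanarGeometry
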